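import Literature.Analysis.FluidPDE.LocalLeraySolutionsSlab
import HarnessLib

/-!
# The local `L^{3/2}` bound for the pressure of a local Leray solution on a slab — named fact

Analysis/FluidPDE fact file (D-0014 named fact, nothing asserted) in the decomposition of the
named fact `Literature.Analysis.FluidPDE.lemarieRieusset_singular_point_stability`
(`NSSereginMildFacts.lean`; Lemarié-Rieusset, *The Navier–Stokes Problem in the 21st Century*,
proof of Thm. 15.5, PDF pp. 571–573 of the held scan: the stability of a singular point at the
final time under local `L²` convergence of local Leray solutions with uniform local-energy
control). That proof controls the pressures of the approximants near the putative singular point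
through the **local pressure representation of local Leray solutions**,
`p = ϖ(s) + Σ RᵢRⱼ(1_{B(0,r₀)} vᵢvⱼ) + (far-field integrals)` (p. 571), which for Lemarié-Rieusset's
own class (Def. 14.1 with Def. 6.13: `∇p = (Id - ℙ) div(𝔽 - u ⊗ u)`) is part of the definition,
and for the tree's class `IsLocalLeraySolutionOn` (`LocalLeraySolutionsSlab.lean` = Kang–Miura–Tsai,
IMRN 2021, Def. 3.2 on a finite slab: a distributional pressure plus Jia–Šverák's decay
`∫₀ᵀ ∫_{B_R(x₀)} |v|² → 0` at spatial infinity) is a theorem: Kang–Miura–Tsai 2021, **Lemma 3.4**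
(pressure decomposition; announced without proof by Jia–Šverák, Invent. Math. 196 (2014), remark
after Def. 1, and SIAM J. Math. Anal. 45 (2013)), whose proof (Appendix, §8 of arXiv:1812.10509,
p. 17) prints the quantitative consequence

  `‖p̄_{x₀,R}‖_{L^s(0,T; L^q(B_{3R/2}(x₀)))} ≤ c(T, R, s, q) A`,  `2/s + 3/q ≥ 3`, `1 < q ≤ 3`,

where `π = p̄_{x₀,R} + c_{x₀,R}(t)` on `B_R(x₀) × (0,T)` with `c_{x₀,R} ∈ L^s(0,T)` and `A` is
the uniformly local energy of the solution on `(0, T)`,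
`ess sup_{0<t<T} ‖v(t)‖²_{L²_uloc} + sup_x ∫₀ᵀ ∫_{B₁(x)} |∇v|² ≤ A` (loc. cit., first display of
the proof). With `s = q = 3/2` this is the statement vendored here:

* `kangMiuraTsai_local_pressure_bound` — for `T, R > 0` and `A ≥ 0` there is `K = K(T, R, A)`
  such that every local Leray solution `(v, π)` on `(0, T) × ℝ³` (unit viscosity, datum
  `v₀ ∈ L²_uloc` weakly divergence free) whose uniformly local energy on unit balls is `≤ A`
  admits, at every centre `x₀`, a time gauge `c ∈ L^{3/2}(0, T)` with
  `∫₀ᵀ ∫_{B_R(x₀)} |π - c(t)|^{3/2} ≤ K`.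

This is exactly the input through which the Rusin–Šverák / Seregin form of the stability
argument (pressure decay estimate `seregin_sverak_pressure_decay` iterated along scales, then the
ε-regularity criterion) reaches local Leray solutions: it is the bound, uniform along a sequence
with uniform local-energy control, on the un-normalised pressure quantity `D(r₀)` at the starting
scale (compare the field `pressure_bound` of `RusinSverak2011.CompactnessSituation`,
`RusinSverakLerayStability.lean`, which *assumes* it for suitable weak solutions).

## Transcription notes

* *Which class.* Kang–Miura–Tsai's Def. 3.2 and Jia–Šverák's Def. 1 are global in time
  (`ℝ³ × (0, ∞)`); the lemma and its proof concern one finite window `(0, T)` at a time (the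
  energy `A`, the mild reconstruction `v̄`, the Liouville step all live on `(0, T)`), and
  Lemarié-Rieusset's Def. 14.1, with which the tree identifies its slab class, is on `(0, T)`;
  the fact is stated for the tree's slab class `IsLocalLeraySolutionOn T 1 v₀ v π`.
* *The datum.* Jia–Šverák's standing hypotheses (Invent. Math. 2014, before Def. 1:
  "`u₀ ∈ L²_loc(ℝ³)` with `div u₀ = 0` and `sup_{x₀} ∫_{B₁(x₀)} |u₀|² < ∞`") are rendered as
  `IsWeaklyDivFree v₀` and `∫_{B₁(x₀)} |v₀|² ≤ A` for all `x₀` (the same `A`: for a local Leray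
  solution `‖v₀‖²_{L²_uloc} ≤ ess sup_t ‖v(t)‖²_{L²_uloc}` by the `L²_loc` attainment of the datum);
  Kang–Miura–Tsai print `v₀ ∈ E²` (they use it only to give the mild reconstruction `v̄` spatial
  decay, Appendix p. 18). The constant does not depend on the datum, as printed (`c(T,R,s,q) A`).
* *Quantifiers and constants.* Printed: one constant `c(T, R, s, q)`, linear dependence on `A`,
  ball `B_{3R/2}(x₀)`; vendored (weaker): `∀ T R A, ∃ K`, ball `B_R(x₀)`. Unit viscosity as in
  all the sources (Kang–Miura–Tsai, Jia–Šverák, Kikuchi–Seregin, Bradshaw–Tsai normalise `ν = 1`).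
* The uniformly local energy hypotheses copy the fields `uniformLocalEnergy` (`R = 1`, a.e. in
  time) and `uniformLocalGradient` (`R = 1`) of `IsLocalLeraySolutionOn` with the explicit
  constant `A`; the gauge is `MemLp c (3/2)` on `(0, T)` (measurability included), the bound an
  `ℝ≥0∞`-valued `lintegral` (no integrability side conditions needed).
* Nothing is asserted: users take `(h : kangMiuraTsai_local_pressure_bound)`. Discharging it is
  the local pressure *representation* for the slab class (next section: it holds with **no**
  hypothesis on the datum) followed by the two printed bounds of Kang–Miura–Tsai §8 — the
  Calderón–Zygmund bound on `L^{3/2}` for the near part (tree: PROVED,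
  `stein1970_normalisedPressure_ae_Lp_bound_holds`, `LocalLerayPressureDecompositionProofs.lean`;
  slice form `exists_lintegral_localPressureNear_le`, `LerayPressureDecayProofs.lean`) and the
  kernel bound `|K(x - y) - K(x₀ - y)| ≲ R |x₀ - y|⁻⁴` for the far part (tree: PROVED,
  `exists_abs_pressureKernel_sub_le`, `enorm_localPressureFar_le`,
  `lintegral_compl_ball_mul_powKer_le`).

## Source at the vendored generality, and the discharge route (review of the split, 2026-08-15)

*Why the `E²` hypothesis of the printed Lemma 3.4 is not needed here.* Kang–Miura–Tsai use
`v₀ ∈ E²` at exactly one place (§8, arXiv p. 18: the spatial decay of the mild reconstruction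
`v̄`, through `v₀^ε ∈ C^∞_{c,σ}`, `v₀^ε → v₀` in `L²_uloc`), before the Liouville step `v = v̄`.
The representation itself is a statement about the pair `(v, π)` on the open slab and is
covered, at the generality vendored here (indeed for *any* datum), by the characterisation of the
pressure of Fernández-Dalgo–Lemarié-Rieusset (DCDS-S 14 (2021), **Thm. 1**, `d = 3`, `𝔽 = 0`):

> Let `0 < T < ∞` and let `u ∈ L²((0,T), L²(ℝ³, (1+|x|)⁻⁴ dx))` be divergence free with
> `∂ₜu = Δu − ∇·(u ⊗ u) − S`, `∇ ∧ S = 0`, `S ∈ 𝒟'((0,T) × ℝ³)`. Choose `φ ∈ 𝒟(ℝ³)` equal to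
> `1` near `0` and put `A_{ij,φ} = (1 − φ)∂ᵢ∂ⱼG₃`, `G₃ = 1/(4π|x|)`. Then there is
> `g ∈ L¹((0,T))` with `S = ∇p_φ + ∂ₜg`,
> `p_φ = Σᵢⱼ (φ∂ᵢ∂ⱼG₃) * (uᵢuⱼ) + Σᵢⱼ ∫ (A_{ij,φ}(x−y) − A_{ij,φ}(−y)) uᵢuⱼ(t,y) dy`;
> `∇p_φ` does not depend on `φ` [...]; if `u ∈ L²((0,T), L²((1+|x|)⁻³dx))` then `g = 0`.

(Proof, ibid. §5: `Ũ = S − ∇p_φ` is harmonic in `x`; mollified in space–time it lies in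
`L¹((1+|x|)⁻⁴dx)`, hence is a tempered harmonic distribution, hence a polynomial, hence a
constant; so `S = ∇p_φ + f(t)`.) The same mechanism is Lemarié-Rieusset's book, 2nd ed., §6.3
Def. 6.4–6.5 and Prop. 6.3 (Leray projection of fields "vanishing at infinity", held scan PDF
pp. 129–132), §6.4 Lemma 6.4 (B) (p. 133: "if `u` and `f` vanish at infinity, then
`∇p = f − ℙf`") and §6.5 Thm. 6.1 (p. 134, for `u ∈ L²((0,T), L²((1+|x|)⁻⁴dx))`, footnote 4:
"`(L²L²)_uloc ⊂ L²((0,T), L²((1+|x|)⁻⁴dx))`"); Bradshaw–Tsai, JMFM 24 (2022), Thms. 1.4–1.5,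
prove "mild ⇔ local pressure expansion" for `u ∈ L²_uloc(0,T)` and note (p. 4) that Jia–Šverák's
decay condition implies mildness. For a slab local Leray solution `(v, π)`
(`IsLocalLeraySolutionOn T 1 v₀ v π`): `v ∈ L^∞(0,T; L²_uloc) ⊂ L²((0,T), L²((1+|x|)⁻⁴dx))` and
`S = ∇π`, so `∇π = ∇p_φ + f(t)`; testing against `θ(t)ψ(x − z)` and letting `|z| → ∞`, every
term of `S − ∇p_φ = −∂ₜv + Δv − ∇·(v ⊗ v) − ∇p_φ` tends to `0` by the decay clause (7)
(`∫₀ᵀ∫_{B_R(z)} |v|² → 0`; for `∇p_φ` through the bounds below and the decay of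
`∫₀ᵀ∫_{B_R(z)} |v|³`, `IsLocalLeraySolutionOn.tendsto_lintegral_cube_cocompact`), while
`⟨f, θ ⊗ ψ(· − z)⟩ = ∫ f θ · ∫ ψ` does not depend on `z`: hence `f = 0`, `∇(π − p_φ) = 0` on the
slab, and `π = p_φ + c(t)`; on `B_R(x₀)` the chart form `p_φ = π_loc + π_far + const(t)`
(`localPressureNear x₀ R v`, `localPressureFar x₀ R v` of `LocalLerayPressureDecomposition.lean`)
is the printed computation of Bradshaw–Tsai (1.6)/(GijB). Parasitic pairs `v = a(t)`,
`π = −a'(t)·x` (Bradshaw–Tsai p. 6) show that (7) cannot be dropped; the datum plays no role.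

*Discharge route (inline, no new named facts; sizes are estimates).* Work at a fixed centre `x₀`
with the charts `(x₀, k)`, `k ≥ R`, and the tree's `π_loc^{(x₀,k)} = p̃[1_{B_{2k}(x₀)} v(t)]`,
`π_far^{(x₀,k)}`; write `P_k = π_loc^{(x₀,k)} + π_far^{(x₀,k)}`.
1. *Poisson equations* (≈ 300 lines). `∫∫ π Δθ = −∫∫ D²θ(v,v)` on the slab is the tree's
   `IsDistributionalNSSolutionOn.integral_hessian_add_pressure_laplacian_eq_zero`. For the near
   part, `∫ p̃[w] Δψ = −∫ D²ψ(w,w)` for `w = 1_{B}v(t) ∈ L³` (a.e. `t`): smooth case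
   `integral_normalisedPressure_mul_laplacian` (`NormalisedPressureCompactSupport.lean`), then
   `wₙ → w` in `L³` with `‖p̃[w] − p̃[w']‖_{3/2} ≤ C ‖|w − w'|(|w| + |w'|)‖_{3/2}` on the `L³` class
   (polarisation `truncatedPressureIntegral_eq_sum_rieszTrunc`, `rieszTrunc_sub`,
   `exists_eLpNorm_rieszTrunc_le` uniformly in `ε`, `ae_exists_hasPressurePV`, Fatou), and the
   two limit lemmas `tendsto_integral_mul_of_tendsto_eLpNorm_sub`,
   `tendsto_integral_hessian_apply_of_tendsto_eLpNorm` (`WholeSpacePressureL3.lean`). For the far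
   part, `x ↦ π_far(t,x)` is `C²` on `B_k(x₀)` with `Δ_x π_far = 0` (differentiate twice under the
   integral over `|y − x₀| ≥ 2k` with `pressureKernel_eq_neg_fderiv2`,
   `exists_norm_fderiv3_newtonKernel_le`, `exists_norm_fderiv4_newtonKernel_le`,
   `laplacian_newtonKernel`, the weights by `lintegral_mul_le_of_forall_lintegral_ball_le`; the
   pattern is `fderiv_fderiv_farPotential_apply_apply`, `NormalisedPressureFarFieldHessian.lean`).
2. *Overlap identities* (≈ 300 lines; absolutely convergent bookkeeping with
   `HasPressurePV.add_of_disjoint`, `NormalisedPressureDisjointAdd.lean`, and "the principal value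
   of a field vanishing near `x` is the plain integral"): for `j ≤ k`,
   `P_k − P_j = ∫_{2j ≤ |y−x₀| < 2k} K(x₀ − y)(v(t,y)) dy` on `B_j(x₀)`; for `B_1(z)` with
   `|z − x₀| + 4 ≤ k`, `P_k − P^{(z,1)} = ∫_{B_{2k}(x₀)∖B_2(z)} K(z − y)(v) dy +
   ∫_{|y−x₀| ≥ 2k} (K(z − y) − K(x₀ − y))(v) dy` on `B_1(z)` — both independent of `x`.
3. *Bounds and decay* (mostly in the tree): near part by `exists_lintegral_localPressureNear_le`
   with `stein1970_normalisedPressure_ae_Lp_bound_holds` and the cubic functional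
   (`exists_lintegral_cube_box_le_explicit`, `setLIntegral_ball_le_of_forall_unitBall`,
   `LocalLerayPressureBoundTools.lean`; decay `IsLocalLeraySolutionOn.tendsto_lintegral_cube_cocompact`);
   far part by `enorm_localPressureFar_le`, `lintegral_compl_ball_mul_powKer_le`,
   `tendsto_lintegral_compl_ball_powKer_four_atTop` (split at a radius `ρ`, as in
   `lintegral_gauged_pressure_le`).
4. *The Liouville step* (≈ 500 lines; Fernández-Dalgo–Lemarié-Rieusset §5 with bounded instead of
   tempered functions). `Λ(Φ) := ∫∫ ⟨v, ∂ₜΦ + ΔΦ⟩ + (v ⊗ v) : ∇Φ + ∫∫ P_k div Φ` for test fields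
   `Φ` supported in `(0,T) × B_k(x₀)` (independent of `k` by step 2; equal to
   `−∫∫ (π − P_k) div Φ` by the momentum equation). By step 1, `Λ(ΔₓΦ) = 0`. For a space–time bump
   `ρ` and `t ∈ (δ, T − δ)` put `F(t,x) = Λ(ρ((t,x) − ·) eᵢ)`; re-charting at `(x, 1)` (step 2,
   `∫ div Φ dx = 0`) and step 3 give `|F| ≤ C(ρ, T, A)`, continuity in `x`, and `F(t,x) → 0` as
   `|x| → ∞`; weak harmonicity `∫ F(t,x) Δψ(x) dx = Λ(Δₓ(ψ ⋆ ρ) eᵢ) = 0`. Mollify: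
   `laplacian_normed_convolution_eq_zero` (`WeaklyHarmonicInteriorBound.lean`),
   `harmonicOnNhd_of_laplacian_eq_zero`, and `harmonic_eq_zero_of_tendsto_cocompact'`
   (`HarmonicVanishing.lean`) give `ψₙ ⋆ F(t,·) = 0`, so `F = 0`, so `Λ = 0`.
5. *Gauge and assembly* (≈ 300 lines). `Λ = 0` is `∫∫ (π − P_k) ∂_a θ = 0`; glue
   `Q = π − P_k + (P_k − P_R)|_{B_R}` consistently over `k` (step 2) and apply
   `ae_restrict_exists_ae_eq_const_of_forall_integral_mul_fderiv_eq_zero`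
   (`ForwardDSSExistenceLocalProofs.lean`): `π = π_loc^{(x₀,R)} + π_far^{(x₀,R)} + c(t)` a.e. on
   `(0,T) × B_R(x₀)`, `c = ⨍_{B_R(x₀)}(π − P_R) ∈ L^{3/2}(0,T)` measurable (pattern
   `exists_gauge_of_pressure_decomposition`). Then `∫∫_{B_R} |π − c|^{3/2} ≤ √2(near + far)`
   with step 3 and `A`; radii `R < 1` by `kangMiuraTsai_local_pressure_bound.mono_radius`.
The representation theorem of step 5, stated for `IsLocalLeraySolutionOn` in the shape of
`kangMiuraTsai_pressure_decomposition`, also discharges that fact (**PD**, global class, `E²`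
datum) through `IsLocalLeraySolution.isLocalLeraySolutionOn`. Not needed on this route: mild
solutions in `L^q_uloc`, the Oseen kernel, Maekawa–Terasawa's estimates, heat-equation uniqueness.

## Mathlib / tree search

Tree: the printed Lemma 3.4 itself — the *exact expansion* `π = π_loc + π_far + c_{x₀,r}(t)` with
`π_loc = p̃[1_{B_{2r}(x₀)} v(t)]` (the Riesz-transform pressure `normalisedPressure`) and the
explicit far-field integral — is the named fact **PD** `kangMiuraTsai_pressure_decomposition`
(`LocalLerayPressureDecomposition.lean`, with `localPressureNear`, `localPressureFar` and Stein's
a.e. `L^p` bound `stein1970_normalisedPressure_ae_Lp_bound`), stated for the **global** class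
`IsLocalLeraySolution` (Kang–Miura–Tsai Def. 3.2 on `(0, ∞) × ℝ³`) with the printed **`E²` datum**,
and consumed by `LerayPressureDecayProofs.lean`. The present fact is a different object — the
slab class `IsLocalLeraySolutionOn` on `(0, T)`, Jia–Šverák's `L²_uloc` datum (no `E²` decay,
which the slab class cannot supply: its solution clauses give the datum's `L²_uloc` bound and weak
divergence-freeness, not decay), and only the *quantitative consequence* of the expansion, the
bound `c(T, R) A` — so **PD** together with the Calderón–Zygmund bound and the far-field kernel
bound yields it only for global solutions with `E²` data; the present fact is discharged by the
datum-free representation of the previous section (which also yields **PD**). Elsewhere the expansion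
appears only *bundled*: in the decay fact `leray_solution_ckn_decay`
(`LerayFarFieldEpsilonRegularity.lean`: KMT Lemmas 3.3–3.4 as the decay of
`∫∫ |v|³ + |π - c_{x₀}(t)|^{3/2}` at spatial infinity, global class, `L³` data) and as the assumed
field `pressure_bound` of `RusinSverak2011.CompactnessSituation`. Consumers of the present fact:
`NSSereginMildStabilityCore.lean` / `NSSereginMildStability.lean` (reduction of
`lemarieRieusset_singular_point_stability`) and `LocalEnergyLimitBounds.lean`
(`Seregin2014Limit.exists_pressure_gauge`, reduction of `seregin2014_localEnergy_limitingProcedure`).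
Liouville / harmonic tools already in the tree: `HarmonicVanishing.lean`,
`WeaklyHarmonicInteriorBound.lean`, `HarmonicLiouvilleLp.lean`, `WeylLemmaBall.lean`.
Reused: `IsLocalLeraySolutionOn`,
`HasWeakSpatialGradientOn`, `slab`, `frobeniusNormSq`, `IsWeaklyDivFree`. Mathlib: `MemLp`,
`eLpNorm`, set `lintegral`s.

## References

* K. Kang, H. Miura, T.-P. Tsai, *Short time regularity of Navier–Stokes flows with locally `L³`
  initial data and applications*, IMRN 2021 (11) 8763–8805 = arXiv:1812.10509: §3 Def. 3.1
  (5) (`c_{x₀} ∈ L^{3/2}(0,T)`), Def. 3.2, **Lemma 3.4** (pressure decomposition) and its proof,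
  Appendix §8 (arXiv p. 17: the bound `‖p̄_{x₀,R}‖_{L^sL^q(B_{3R/2}(x₀) × (0,T))} ≤ c(T,R,s,q) A`).
  Bib key `KangMiuraTsai2020`.
* H. Jia, V. Šverák, Invent. Math. 196 (2014) 233–265 = arXiv:1204.0529, §3, Def. 1 and the remark
  following it (arXiv p. 7: the decay condition "allows us to calculate `p`" by the local
  representation). Bib key `JiaSverak2014`.
* P. G. Lemarié-Rieusset, *The Navier–Stokes Problem in the 21st Century* (held scan = 2nd ed.,
  doi:10.1201/9781003042594; 1st ed. doi:10.1201/b19556): Def. 6.13, §14.1 (PDF pp. 488–492: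
  `∇p = (Id - ℙ) div ℍ` on `L¹_uloc`, the local pressure `p_{x₀}` and the bounds (14.9)),
  Def. 14.1 (p. 498), proof of Thm. 15.5 (p. 571, the split `ϖ + p₁ + p₂,R + p₃,R`).
  Bib keys `LemarieRieusset2016`, `Lemarierieusset2023`.
* N. Kikuchi, G. Seregin, AMS Transl. (2) 220 (2007) 141–164, Def. 1.1, (1.3)–(1.4).
  Bib key `KikuchiSeregin2007`.
* P. G. Fernández-Dalgo, P. G. Lemarié-Rieusset, *Characterisation of the pressure term in the
  incompressible Navier–Stokes equations on the whole space*, Discrete Contin. Dyn. Syst. Ser. S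
  14 (2021) 2917–2931 = arXiv:2001.10436: Lemma 1.1, **Thm. 1** (§1) and its proof (§5);
  Props. 3.1, 4.1 (the Poisson problems). Bib key `FernandezdalgoLemarierieusset2021`.
* P. G. Lemarié-Rieusset, op. cit., 2nd ed., §6.3 Def. 6.4–6.5, Prop. 6.3 (held scan PDF
  pp. 129–132), §6.4 Lemma 6.4 (p. 133), §6.5 Thm. 6.1 with footnote 4 (p. 134).
* Z. Bradshaw, T.-P. Tsai, *On the local pressure expansion for the Navier–Stokes equations*,
  J. Math. Fluid Mech. 24 (2022) = arXiv:2001.11526: Defs. 1.1–1.3, Thms. 1.4–1.5 and the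
  comments following them (parasitic solutions; "the condition from [JiaSverak] implies `u` is a
  mild solution"). Bib key `BradshawTsai2021`.
-/

noncomputable section

open MeasureTheory TopologicalSpace Set Function Filter Metric
open _root_.Topology
open scoped ENNReal NNReal RealInnerProductSpace

namespace Literature.Analysis.FluidPDE

/-- NAMED FACT (**local `L^{3/2}` bound for the gauged pressure of a local Leray solution**;
Kang–Miura–Tsai, IMRN 2021 = arXiv:1812.10509, **Lemma 3.4** (pressure decomposition): "Suppose
`(v, π)` is a local Leray solution to (NS) with divergence free initial data `v₀ ∈ E²` in the
sense of Definition 3.2. For any `x₀ ∈ ℝ³`, `r > 0`, and `T > 0`, we have for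
`(x,t) ∈ Q := B_r(x₀) × (0,T)`, `π(x,t) = π_loc(x,t) + π_far(x,t) + c_{x₀,r}(t)` [...] for some
function `c_{x₀,r}(t) ∈ L^{3/2}(0,T)`", with the estimate printed in its proof (Appendix §8,
arXiv p. 17): under `ess sup_{0<t<T} ‖v(t)‖²_{L²_uloc} + sup_{x ∈ ℝ³} ∫₀ᵀ ∫_{B₁(x)} |∇v|² ≤ A`,
"`‖p̄_{x₀,R}‖_{L^s(0,T; L^q(B_{3R/2}(x₀)))} ≤ c(T,R,s,q) A`" for `2/s + 3/q ≥ 3`, `1 < q ≤ 3`,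
where `π = p̄_{x₀,R} + c_{x₀,R}(t)` on `B_R(x₀)`; the representation is announced for local Leray
solutions with `L²_uloc` divergence-free data and spatial decay by Jia–Šverák, Invent. Math. 196
(2014), remark after Def. 1, and is definitional for Lemarié-Rieusset's Def. 14.1 (Def. 6.13,
§14.1, bounds (14.9)). Transcription (module docstring), case `s = q = 3/2`, unit viscosity:
for `T, R > 0`, `A ≥ 0` there is `K` such that for every local Leray solution `(v, π)` on the
slab `(0, T) × ℝ³` (`IsLocalLeraySolutionOn T 1 v₀ v π`) with datum `v₀ ∈ L²_uloc`
(`∫_{B₁(x₀)} |v₀|² ≤ A` for all `x₀`) weakly divergence free, with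
`∫_{B₁(x₀)} |v(t)|² ≤ A` for a.e. `t ∈ (0,T)` and all `x₀`, and with a weak spatial gradient
`G = ∇v` on the slab satisfying `∫₀ᵀ ∫_{B₁(x₀)} |G|² ≤ A` for all `x₀`, and for every centre
`x₀`, there is a gauge `c ∈ L^{3/2}(0, T)` with `∫₀ᵀ ∫_{B_R(x₀)} |π - c(t)|^{3/2} ≤ K`. Users
take `(h : kangMiuraTsai_local_pressure_bound)`.
[cite: KangMiuraTsai2020, Lemma 3.4 and its proof, Appendix §8 (arXiv:1812.10509 pp. 8, 17)] [cite: JiaSverak2014, §3 remark after Def. 1 (arXiv:1204.0529 p. 7)] -/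
def kangMiuraTsai_local_pressure_bound : Prop :=
  ∀ (T R : ℝ) (A : ℝ≥0), 0 < T → 0 < R → ∃ K : ℝ≥0,
    ∀ (v₀ : EuclideanSpace ℝ (Fin 3) → EuclideanSpace ℝ (Fin 3))
      (v : ℝ → EuclideanSpace ℝ (Fin 3) → EuclideanSpace ℝ (Fin 3))
      (π : ℝ → EuclideanSpace ℝ (Fin 3) → ℝ),
      IsLocalLeraySolutionOn T 1 v₀ v π →
      (∀ x₀ : EuclideanSpace ℝ (Fin 3), ∫⁻ x in ball x₀ 1, ‖v₀ x‖ₑ ^ 2 ≤ A) →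
      IsWeaklyDivFree v₀ →
      (∀ᵐ t ∂(volume.restrict (Ioo 0 T)), ∀ x₀ : EuclideanSpace ℝ (Fin 3),
        ∫⁻ x in ball x₀ 1, ‖v t x‖ₑ ^ 2 ≤ A) →
      (∃ G : ℝ → EuclideanSpace ℝ (Fin 3) →
          EuclideanSpace ℝ (Fin 3) →L[ℝ] EuclideanSpace ℝ (Fin 3),
        HasWeakSpatialGradientOn
            (slab (EuclideanSpace ℝ (Fin 3)) (Ioo 0 T) isOpen_Ioo) v G ∧
          ∀ x₀ : EuclideanSpace ℝ (Fin 3), ∫⁻ z in Ioo 0 T ×ˢ ball x₀ 1,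
            ENNReal.ofReal (frobeniusNormSq (G z.1 z.2)) ≤ A) →
      ∀ x₀ : EuclideanSpace ℝ (Fin 3), ∃ c : ℝ → ℝ,
        MemLp c (3 / 2 : ℝ≥0∞) (volume.restrict (Ioo 0 T)) ∧
          ∫⁻ z in Ioo 0 T ×ˢ ball x₀ R, ‖π z.1 z.2 - c z.1‖ₑ ^ (3 / 2 : ℝ) ≤ K

/-- **Monotonicity in the radius** (bookkeeping for users): under
`kangMiuraTsai_local_pressure_bound`, the bound for radius `R` serves every `R' ≤ R` with the
same gauge (the integral over `(0,T) × B_{R'}(x₀)` is dominated by that over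
`(0,T) × B_R(x₀)`). [folklore] -/
theorem kangMiuraTsai_local_pressure_bound.mono_radius (h : kangMiuraTsai_local_pressure_bound)
    {T R R' : ℝ} {A : ℝ≥0} (hT : 0 < T) (hR : 0 < R) (hR' : R' ≤ R) :
    ∃ K : ℝ≥0, ∀ (v₀ : EuclideanSpace ℝ (Fin 3) → EuclideanSpace ℝ (Fin 3))
      (v : ℝ → EuclideanSpace ℝ (Fin 3) → EuclideanSpace ℝ (Fin 3))
      (π : ℝ → EuclideanSpace ℝ (Fin 3) → ℝ),
      IsLocalLeraySolutionOn T 1 v₀ v π →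
      (∀ x₀ : EuclideanSpace ℝ (Fin 3), ∫⁻ x in ball x₀ 1, ‖v₀ x‖ₑ ^ 2 ≤ A) →
      IsWeaklyDivFree v₀ →
      (∀ᵐ t ∂(volume.restrict (Ioo 0 T)), ∀ x₀ : EuclideanSpace ℝ (Fin 3),
        ∫⁻ x in ball x₀ 1, ‖v t x‖ₑ ^ 2 ≤ A) →
      (∃ G : ℝ → EuclideanSpace ℝ (Fin 3) →
          EuclideanSpace ℝ (Fin 3) →L[ℝ] EuclideanSpace ℝ (Fin 3),
        HasWeakSpatialGradientOn
            (slab (EuclideanSpace ℝ (Fin 3)) (Ioo 0 T) isOpen_Ioo) v G ∧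
          ∀ x₀ : EuclideanSpace ℝ (Fin 3), ∫⁻ z in Ioo 0 T ×ˢ ball x₀ 1,
            ENNReal.ofReal (frobeniusNormSq (G z.1 z.2)) ≤ A) →
      ∀ x₀ : EuclideanSpace ℝ (Fin 3), ∃ c : ℝ → ℝ,
        MemLp c (3 / 2 : ℝ≥0∞) (volume.restrict (Ioo 0 T)) ∧
          ∫⁻ z in Ioo 0 T ×ˢ ball x₀ R', ‖π z.1 z.2 - c z.1‖ₑ ^ (3 / 2 : ℝ) ≤ K := by
  obtain ⟨K, hK⟩ := h T R A hT hR
  refine ⟨K, fun v₀ v π hv h₀ hdiv hE hG x₀ => ?_⟩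
  obtain ⟨c, hc, hb⟩ := hK v₀ v π hv h₀ hdiv hE hG x₀
  exact ⟨c, hc,
    (lintegral_mono_set (Set.prod_mono Subset.rfl (ball_subset_ball hR'))).trans hb⟩

end Literature.Analysis.FluidPDE

end
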